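import Literature.Analysis.FluidPDE.TimeAverageEnstrophy
import Literature.Analysis.FluidPDE.RestartedEnergyChainRule
import HarnessLib

/-!
# The generalized energy inequality of a global Leray–Hopf solution with steady force

Analysis/FluidPDE support file for the discharge of
`Literature.Analysis.FluidPDE.timeAverage_isStationary` (Foias–Manley–Rosa–Temam 2001, Ch. IV
Thm. 3.1 with App. B.2), property (1.31). For a global Leray–Hopf weak solution `u` of the
space-periodic Navier–Stokes equations on `T^d` with viscosity `ν > 0`, steady force `F ∈ L²`
and datum `u₀`, and for every bounded Lipschitz `φ ≥ 0` (`φ = ρ'`), the **generalized energy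
inequality** (FMRT 2001, App. B.2, (B.33)–(B.36), PDF pp. 260–261)

  `∫_{|u₀|²}^{|u(T)|²} φ ≤ ∫₀ᵀ φ(|u(t)|²) · 2[(F, u(t)) − ν ‖∇u(t)‖₂²] dt`     (T > 0)

(`IsGlobalLerayHopf.intervalIntegral_le_setIntegral_flux`), whence the lower bound
`∫₀ᵀ φ(|u|²) 2[(F,u) − ν‖∇u‖²] ≥ −M |u₀|²` on the time integrals (`…neg_le_setIntegral_flux`,
(B.36)). The real-analysis core is `RestartedChainRule.intervalIntegral_le_setIntegral`
(`RestartedEnergyChainRule`: Steklov averaging and Lebesgue differentiation, a route different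
from the partitions of the printed proof); this file only feeds it the Leray–Hopf energy
inequality from `s = 0` and from a.e. `s > 0` (the fields `energy_ineq_zero`, `energy_ineq_ae`
of `Torus.IsLerayHopfOn`; FMRT Ch. II (7.20)), rewritten in flux form
(`…integral_norm_sq_le_add_setIntegral_flux`, `…ae_restart_flux`), together with the
measurability, integrability and uniform boundedness of the energy `t ↦ |u(t)|²`
(`LerayHopfSpectralMeasurability`, `LerayHopfUniformEnergy`).

## References

* C. Foias, O. Manley, R. Rosa, R. Temam, *Navier–Stokes Equations and Turbulence*, Cambridge
  Univ. Press (2001), Ch. II §7 (7.20) (PDF p. 74); App. B.2 (B.33)–(B.36) (PDF pp. 260–261).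
  [FMRT2001]
-/

noncomputable section

open MeasureTheory Set Filter Topology UnitAddTorus
open scoped InnerProductSpace RealInnerProductSpace ENNReal NNReal

namespace Literature.Analysis.FluidPDE.Torus

variable {d : Type*} [Fintype d] [DecidableEq d]

variable {ν : ℝ} {F u₀ : (UnitAddTorus d → EuclideanSpace ℝ d)} {u : ℝ → (UnitAddTorus d → EuclideanSpace ℝ d)} {U : ℝ → FunctionSpaces.Torus.energySpace d}

/-! ### The forcing pairing along the trajectory -/

omit [DecidableEq d] in
/-- `|(F, w)| ≤ ½ (|F|² + |w|²)` for `F, w ∈ L²(T^d)` (Young). [folklore] -/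
theorem abs_integral_inner_le_half (hF : MemLp F 2 volume) {w : (UnitAddTorus d → EuclideanSpace ℝ d)} (hw : MemLp w 2 volume) :
    |∫ x, ⟪F x, w x⟫| ≤ 2⁻¹ * ((∫ x, ‖F x‖ ^ 2) + ∫ x, ‖w x‖ ^ 2) := by
  have h1 := integral_inner_le_young one_pos hF hw
  have h2 := integral_inner_le_young one_pos hF.neg hw
  have hneg : ∫ x, ⟪(-F) x, w x⟫ = -∫ x, ⟪F x, w x⟫ := by
    rw [← integral_neg]
    exact integral_congr_ae (ae_of_all _ fun x => by simp [inner_neg_left])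
  have hnorm : ∫ x, ‖(-F) x‖ ^ 2 = ∫ x, ‖F x‖ ^ 2 :=
    integral_congr_ae (ae_of_all _ fun x => by simp)
  rw [hneg, hnorm] at h2
  rw [abs_le]
  constructor <;> linarith

/-- The forcing pairing `t ↦ (F, u(t))` of a global Leray–Hopf solution with steady `L²` force
is integrable on every `(0, T]` (weakly continuous on `(0, T]`, and bounded through the
uniform energy bound). [folklore] -/
theorem IsGlobalLerayHopf.integrableOn_integral_inner_force (hν : 0 < ν) (hF : MemLp F 2 volume)
    (hu : IsGlobalLerayHopf ν (fun _ => F) u₀ u)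
    (hU : ∀ t, 0 ≤ t → ((U t : (Lp (EuclideanSpace ℝ d) 2 (volume : Measure (UnitAddTorus d)))) : (UnitAddTorus d → EuclideanSpace ℝ d)) =ᵐ[volume] u t) {T : ℝ} (hT : 0 < T) :
    IntegrableOn (fun t => ∫ x, ⟪F x, u t x⟫) (Ioc 0 T) := by
  obtain ⟨R, hR⟩ := hu.exists_forall_integral_norm_sq_le hν hF hU
  have hcont : ContinuousOn (fun t => ∫ x, ⟪F x, u t x⟫) (Ioc 0 T) := by
    have h := ((hu T hT).weak_continuous F hF).1
    refine h.congr fun t _ => ?_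
    exact integral_congr_ae (ae_of_all _ fun x => real_inner_comm _ _)
  refine Integrable.of_bound (hcont.aestronglyMeasurable measurableSet_Ioc)
    (2⁻¹ * ((∫ x, ‖F x‖ ^ 2) + R)) ?_
  filter_upwards [ae_restrict_mem measurableSet_Ioc] with t ht
  rw [Real.norm_eq_abs]
  refine (abs_integral_inner_le_half hF (hu.memLp_two ht.1.le)).trans ?_
  gcongr
  exact hR t ht.1.le

/-! ### The dissipation as a real set integral -/

/-- On `(s, t]`, `0 ≤ s ≤ t`, the real slice enstrophy of a global Leray–Hopf solution is
integrable and `∫_{(s,t]} ‖∇u‖₂² = (∫⁻_{(s,t)} ‖∇u‖₂²).toReal`. [folklore] -/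
theorem IsGlobalLerayHopf.setIntegral_toReal_eGradNormSq (hu : IsGlobalLerayHopf ν (fun _ => F) u₀ u)
    {s t : ℝ} (hs : 0 ≤ s) :
    IntegrableOn (fun τ => (FunctionSpaces.Torus.eGradNormSq (u τ)).toReal) (Ioc s t) ∧
      ∫ τ in Ioc s t, (FunctionSpaces.Torus.eGradNormSq (u τ)).toReal =
        (∫⁻ τ in Ioo s t, FunctionSpaces.Torus.eGradNormSq (u τ)).toReal := by
  have hLH := hu (|t| + 1) (by positivity)
  have hsub : Ioo s t ⊆ Ioo 0 (|t| + 1) := Ioo_subset_Ioo hs (by linarith [le_abs_self t])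
  have hmeas : AEMeasurable (fun τ => FunctionSpaces.Torus.eGradNormSq (u τ))
      (volume.restrict (Ioo s t)) :=
    hLH.aemeasurable_eGradNormSq.mono_measure (Measure.restrict_mono hsub le_rfl)
  have hfin : ∫⁻ τ in Ioo s t, FunctionSpaces.Torus.eGradNormSq (u τ) < ∞ :=
    (lintegral_mono_set hsub).trans_lt hLH.lintegral_eGradNormSq_lt_top
  have hlt := ae_lt_top' hmeas hfin.ne
  refine ⟨?_, ?_⟩
  · exact (integrableOn_Ioc_iff_integrableOn_Ioo).mpr
      (integrable_toReal_of_lintegral_ne_top hmeas hfin.ne)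
  · rw [setIntegral_congr_set (Ioo_ae_eq_Ioc (μ := volume) (a := s) (b := t)).symm,
      integral_toReal hmeas hlt]

/-! ### The energy inequality in flux form -/

/-- The flux integral splits: with `g = 2(F,u) − 2ν‖∇u‖₂²`,
`∫_{(s,t]} g = 2 ∫ₛᵗ (F,u) − 2ν (∫⁻_{(s,t)} ‖∇u‖₂²).toReal` for `0 ≤ s ≤ t`. [folklore] -/
theorem IsGlobalLerayHopf.setIntegral_flux_eq (hν : 0 < ν) (hF : MemLp F 2 volume)
    (hu : IsGlobalLerayHopf ν (fun _ => F) u₀ u)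
    (hU : ∀ t, 0 ≤ t → ((U t : (Lp (EuclideanSpace ℝ d) 2 (volume : Measure (UnitAddTorus d)))) : (UnitAddTorus d → EuclideanSpace ℝ d)) =ᵐ[volume] u t) {s t : ℝ} (hs : 0 ≤ s)
    (hst : s ≤ t) :
    ∫ τ in Ioc s t, (2 * (∫ x, ⟪F x, u τ x⟫) -
        2 * ν * (FunctionSpaces.Torus.eGradNormSq (u τ)).toReal) =
      2 * (∫ τ in s..t, ∫ x, ⟪F x, u τ x⟫) -
        2 * ν * (∫⁻ τ in Ioo s t, FunctionSpaces.Torus.eGradNormSq (u τ)).toReal := by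
  have hD := hu.setIntegral_toReal_eGradNormSq (t := t) hs
  have hfi : IntegrableOn (fun τ => ∫ x, ⟪F x, u τ x⟫) (Ioc s t) := by
    rcases lt_or_ge 0 t with ht | ht
    · exact (hu.integrableOn_integral_inner_force hν hF hU ht).mono_set (Ioc_subset_Ioc_left hs)
    · rw [Ioc_eq_empty (not_lt.2 (ht.trans hs))]
      exact integrableOn_empty
  rw [integral_sub (hfi.const_mul 2) (hD.1.const_mul (2 * ν)), integral_const_mul,
    integral_const_mul, hD.2, intervalIntegral.integral_of_le hst]

/-- **Energy inequality from `0` in flux form**: for `t > 0`,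
`|u(t)|² ≤ |u₀|² + ∫_{(0,t]} (2(F,u) − 2ν‖∇u‖₂²)`, where `|u₀|² = 2 · kineticEnergy u₀`
(FMRT 2001, Ch. II (7.20) with `t₀ = 0`). [cite: FMRT2001, Ch. II §7 (7.20)] -/
theorem IsGlobalLerayHopf.integral_norm_sq_le_add_setIntegral_flux (hν : 0 < ν) (hF : MemLp F 2 volume)
    (hu : IsGlobalLerayHopf ν (fun _ => F) u₀ u)
    (hU : ∀ t, 0 ≤ t → ((U t : (Lp (EuclideanSpace ℝ d) 2 (volume : Measure (UnitAddTorus d)))) : (UnitAddTorus d → EuclideanSpace ℝ d)) =ᵐ[volume] u t) {t : ℝ} (ht : 0 < t) :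
    ∫ x, ‖u t x‖ ^ 2 ≤ 2 * FunctionSpaces.Torus.kineticEnergy u₀ +
      ∫ τ in Ioc 0 t, (2 * (∫ x, ⟪F x, u τ x⟫) -
        2 * ν * (FunctionSpaces.Torus.eGradNormSq (u τ)).toReal) := by
  have hE := (hu (t + 1) (by linarith)).energy_ineq_zero t ⟨ht.le, by linarith⟩
  rw [hu.setIntegral_flux_eq hν hF hU le_rfl ht.le]
  have hkin : FunctionSpaces.Torus.kineticEnergy (u t) = 2⁻¹ * ∫ x, ‖u t x‖ ^ 2 := rfl
  rw [hkin] at hE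
  linarith

/-- **Energy inequality from a.e. `s` in flux form**: for a.e. `s ∈ (0, T)` and every
`t ∈ [s, T]`, `|u(t)|² ≤ |u(s)|² + ∫_{(s,t]} (2(F,u) − 2ν‖∇u‖₂²)` (FMRT 2001, Ch. II (7.20)
for almost all `t₀`). [cite: FMRT2001, Ch. II §7 (7.20)] -/
theorem IsGlobalLerayHopf.ae_restart_flux (hν : 0 < ν) (hF : MemLp F 2 volume)
    (hu : IsGlobalLerayHopf ν (fun _ => F) u₀ u)
    (hU : ∀ t, 0 ≤ t → ((U t : (Lp (EuclideanSpace ℝ d) 2 (volume : Measure (UnitAddTorus d)))) : (UnitAddTorus d → EuclideanSpace ℝ d)) =ᵐ[volume] u t) {T : ℝ} (hT : 0 < T) :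
    ∀ᵐ s ∂volume, s ∈ Ioo 0 T → ∀ t ∈ Icc s T,
      ∫ x, ‖u t x‖ ^ 2 ≤ (∫ x, ‖u s x‖ ^ 2) +
        ∫ τ in Ioc s t, (2 * (∫ x, ⟪F x, u τ x⟫) -
          2 * ν * (FunctionSpaces.Torus.eGradNormSq (u τ)).toReal) := by
  have h := (ae_restrict_iff' measurableSet_Ioo).1 (hu T hT).energy_ineq_ae
  filter_upwards [h] with s hs hsI t hst
  have hE := hs hsI t hst
  rw [hu.setIntegral_flux_eq hν hF hU hsI.1.le hst.1]
  have hkt : FunctionSpaces.Torus.kineticEnergy (u t) = 2⁻¹ * ∫ x, ‖u t x‖ ^ 2 := rfl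
  have hks : FunctionSpaces.Torus.kineticEnergy (u s) = 2⁻¹ * ∫ x, ‖u s x‖ ^ 2 := rfl
  rw [hkt, hks] at hE
  linarith

/-! ### The generalized energy inequality -/

/-- The flux `g = 2(F,u) − 2ν‖∇u‖₂²` is integrable on every `(0, T]`. [folklore] -/
theorem IsGlobalLerayHopf.integrableOn_flux_force (hν : 0 < ν) (hF : MemLp F 2 volume)
    (hu : IsGlobalLerayHopf ν (fun _ => F) u₀ u)
    (hU : ∀ t, 0 ≤ t → ((U t : (Lp (EuclideanSpace ℝ d) 2 (volume : Measure (UnitAddTorus d)))) : (UnitAddTorus d → EuclideanSpace ℝ d)) =ᵐ[volume] u t) {T : ℝ} (hT : 0 < T) :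
    IntegrableOn (fun τ => 2 * (∫ x, ⟪F x, u τ x⟫) -
      2 * ν * (FunctionSpaces.Torus.eGradNormSq (u τ)).toReal) (Ioc 0 T) :=
  ((hu.integrableOn_integral_inner_force hν hF hU hT).const_mul 2).sub
    ((hu.setIntegral_toReal_eGradNormSq (t := T) le_rfl).1.const_mul (2 * ν))

/-- **The generalized energy inequality of a global Leray–Hopf solution** (FMRT 2001, App. B.2
(B.33)–(B.36), with `ρ = ∫ φ`): for `ν > 0`, steady `F ∈ L²`, slices lifted to `H`, every
bounded Lipschitz `φ ≥ 0` and every `T > 0`,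
`∫_{|u₀|²}^{|u(T)|²} φ ≤ ∫_{(0,T]} φ(|u(t)|²) (2(F,u(t)) − 2ν‖∇u(t)‖₂²) dt`.
Obtained from the Leray–Hopf energy inequality (from `0` and from a.e. `s`) through the
abstract chain rule `RestartedChainRule.intervalIntegral_le_setIntegral` (Steklov averaging and
Lebesgue differentiation; the printed proof uses partitions through the good set). [cite: FMRT2001, App. B.2 (B.33)–(B.36)] -/
theorem IsGlobalLerayHopf.intervalIntegral_le_setIntegral_flux (hν : 0 < ν) (hF : MemLp F 2 volume)
    (hu : IsGlobalLerayHopf ν (fun _ => F) u₀ u)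
    (hU : ∀ t, 0 ≤ t → ((U t : (Lp (EuclideanSpace ℝ d) 2 (volume : Measure (UnitAddTorus d)))) : (UnitAddTorus d → EuclideanSpace ℝ d)) =ᵐ[volume] u t)
    {φ : ℝ → ℝ} {L : ℝ≥0} {M : ℝ} (hφL : LipschitzWith L φ) (hφ0 : ∀ x, 0 ≤ φ x)
    (hφM : ∀ x, φ x ≤ M) {T : ℝ} (hT : 0 < T) :
    ∫ x in (2 * FunctionSpaces.Torus.kineticEnergy u₀)..(∫ x, ‖u T x‖ ^ 2), φ x ≤
      ∫ t in Ioc 0 T, φ (∫ x, ‖u t x‖ ^ 2) * (2 * (∫ x, ⟪F x, u t x⟫) -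
        2 * ν * (FunctionSpaces.Torus.eGradNormSq (u t)).toReal) := by
  obtain ⟨R, hR⟩ := hu.exists_forall_integral_norm_sq_le hν hF hU
  exact RestartedChainRule.intervalIntegral_le_setIntegral (y := fun t => ∫ x, ‖u t x‖ ^ 2)
    hT hφL hφ0 hφM (hu.integrableOn_integral_norm_sq hT).aestronglyMeasurable
    (fun t ht => by
      rw [abs_of_nonneg (integral_nonneg fun x => sq_nonneg _)]
      exact hR t ht.1.le)
    (hu.integrableOn_flux_force hν hF hU hT)
    (fun t ht => hu.integral_norm_sq_le_add_setIntegral_flux hν hF hU ht.1)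
    (hu.ae_restart_flux hν hF hU hT)

/-- **Lower bound on the weighted time integrals of the flux, FMRT (B.36)**: for `ν > 0`,
steady `F ∈ L²`, bounded Lipschitz `φ` with `0 ≤ φ ≤ M`, and `T > 0`,
`−M |u₀|² ≤ ∫_{(0,T]} φ(|u(t)|²) (2(F,u(t)) − 2ν‖∇u(t)‖₂²) dt`
(from the generalized energy inequality, since `∫_{|u₀|²}^{|u(T)|²} φ ≥ −∫₀^{|u₀|²} φ ≥ −M|u₀|²`). [cite: FMRT2001, App. B.2 (B.36)] -/
theorem IsGlobalLerayHopf.neg_le_setIntegral_flux (hν : 0 < ν) (hF : MemLp F 2 volume)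
    (hu : IsGlobalLerayHopf ν (fun _ => F) u₀ u)
    (hU : ∀ t, 0 ≤ t → ((U t : (Lp (EuclideanSpace ℝ d) 2 (volume : Measure (UnitAddTorus d)))) : (UnitAddTorus d → EuclideanSpace ℝ d)) =ᵐ[volume] u t)
    {φ : ℝ → ℝ} {L : ℝ≥0} {M : ℝ} (hφL : LipschitzWith L φ) (hφ0 : ∀ x, 0 ≤ φ x)
    (hφM : ∀ x, φ x ≤ M) {T : ℝ} (hT : 0 < T) :
    -(M * (2 * FunctionSpaces.Torus.kineticEnergy u₀)) ≤
      ∫ t in Ioc 0 T, φ (∫ x, ‖u t x‖ ^ 2) * (2 * (∫ x, ⟪F x, u t x⟫) -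
        2 * ν * (FunctionSpaces.Torus.eGradNormSq (u t)).toReal) := by
  have h := hu.intervalIntegral_le_setIntegral_flux hν hF hU hφL hφ0 hφM hT
  set E₀ : ℝ := 2 * FunctionSpaces.Torus.kineticEnergy u₀ with hE₀
  have hE₀0 : 0 ≤ E₀ := mul_nonneg zero_le_two (FunctionSpaces.Torus.kineticEnergy_nonneg _)
  have hφc : Continuous φ := hφL.continuous
  have hφi : ∀ a b, IntervalIntegrable φ volume a b := fun a b => hφc.intervalIntegrable a b
  have hsplit : ∫ x in E₀..(∫ x, ‖u T x‖ ^ 2), φ x =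
      (∫ x in E₀..0, φ x) + ∫ x in (0 : ℝ)..(∫ x, ‖u T x‖ ^ 2), φ x :=
    (intervalIntegral.integral_add_adjacent_intervals (hφi _ _) (hφi _ _)).symm
  have h1 : 0 ≤ ∫ x in (0 : ℝ)..(∫ x, ‖u T x‖ ^ 2), φ x :=
    intervalIntegral.integral_nonneg (integral_nonneg fun x => sq_nonneg _) fun x _ => hφ0 x
  have h2 : ∫ x in (0 : ℝ)..E₀, φ x ≤ M * E₀ := by
    have := intervalIntegral.norm_integral_le_of_norm_le_const (a := (0 : ℝ)) (b := E₀)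
      (f := φ) (C := M) fun x _ => by
        rw [Real.norm_eq_abs, abs_of_nonneg (hφ0 x)]; exact hφM x
    rw [sub_zero, abs_of_nonneg hE₀0, Real.norm_eq_abs] at this
    exact (le_abs_self _).trans this
  have h3 : ∫ x in E₀..0, φ x = -∫ x in (0 : ℝ)..E₀, φ x := intervalIntegral.integral_symm _ _
  linarith

end Literature.Analysis.FluidPDE.Torus
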